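import Summits.QuantumFields.BalabanUV.Beta.FP.TorusCompositeUnimodular
import Summits.QuantumFields.BalabanUV.Beta.FP.TorusCompositeObjectsG
import Summits.QuantumFields.BalabanUV.Beta.GAN24.StaircaseFaces

/-!
# `BalabanUV.Beta.FP.TorusNestedReadoutRows` — road «FP», binder row D1, ROUTE T (β1), STUB P (P-b) of the row's ONE file, part 1 of 2 (an2 g76 A-2 l.68669 (3) ∕ W-3
# l.68674 «R-AN2-76-PB»; road W-3 l.68665 (ii)(a), W-5 l.68675; J-NOTE-20 §6∕§8): **(L1) THE ROWS OF THE WRAPPER's NESTED SLICE `N = fromRows (τ₂·Q₁₀) τ₁` READ ONLY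
# FINEST BONDS WITH BOTH ENDPOINTS IN THE SLOT's BIG BLOCK** — over the GENERIC step-row family `Q : StepRows d Lc` (leaf-06 g32 `TorusCompositeObjectsG`) under ONE
# displayed two-block letter (TB); part 2 = `FP/TorusNestedReadoutLocality` (the generators, the evaluation matrix, block-diagonality, the read-out)

WHY.  g53's (D) `FP/TorusNestedGaugeReadout` located the END wrapper's tree-gauge parameter of a source as a finite read-out `E·θ`, `(N·W₀)·θ = −N·X` of the
periodised one-shot chart column `X` through the NESTED slice `N := fromRows (combF Lc M (rs 0) · Q₁₀) τ₁` (`Q₁₀` the composite averaging, `τ₁ = bigP` of the lower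
tower), `W₀ := towerGen`, `E := towerEvalC`.  STUB P (P-b) (an2 A-2 (3), R-AN2-76-PB) asks for LOCALITY: the read-out at a finest site depends on `X` only through the
bonds of that site's BIG block (one `Lc`-block of the top torus `M`, pushed down: ratio `bigRatio Lc (n+1) = Lc^{n+2}` on the finest torus) — the road's W-3 (ii)(a)
READING, here a THEOREM.  This part types the row side: the big block of a nested slot `p` is `quo (bigRatio Lc (n+1)) ((towerEquiv …).symm p).site`
(`= quo Lc t̄` on a top slot `inl t̄`, the `Lc`-block of the lower big block on `inr x` — §1), and **every finest bond `b` read by row `p` of `N` has BOTH endpoints,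
the tip UNWRAPPED, in that block** (§2) — so a bond wrapping around the finest torus is never read (the road's caveats «`combBondT` fallback dead under `Lc ∣ M i`»,
«the averaging never leaves the two blocks of a non-wrapping coarse bond» discharged inside).

WHAT ([folklore] finite `Matrix` ∕ floor-division bookkeeping over OUR torus objects; no `def`, no `def … : Prop`, nothing cited, 0 sorry, default heartbeats):
§0 generic: `exists_of_mul_apply_ne_zero`; **`inv_apply_eq_zero_of_blockDiagonal`** (a matrix vanishing between different fibres of a colouring has an inverse that
does — Mathlib's `⁻¹` is `0` on singular matrices, so NO invertibility is needed); `mulVec_apply_congr_of_support`.  §1 (`quo b ∘ quo a = quo (a·b)` is gan24's `StaircaseFaces.quo_quo`, `quo 1 = id` lit `ResolventComposition.quo_one`)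
`quo_baseOf_tipOf` (both endpoints of the comb bond into `x` lie in `x`'s block: `rootOf_stepOf`), `mem_pbox_of_quo_eq`, `mem_pbox_fine_iff`, the big block of a top ∕
lower slot `quo_towerEquiv_symm_inl ∕ _inr` (`towerEquiv_symm_inl_site ∕ _inr_site` + `quo_lift`).  §2 `bigP_apply_ne_zero(_quo)` (a one-shot comb row reads the comb bond
into its slot, `combBondT_eq`), `combF_apply_ne_zero`, **`compRowsG_apply_ne_zero`** (induction on the depth under the DISPLAYED letter
(TB) `∀ M ℓ r a ν b κ, ↑a + e_ν ∈ pbox M → Q M ℓ r (a,ν) (b,κ) ≠ 0 → quo Lc ↑b ∈ {↑a, ↑a + e_ν} ∧ quo Lc (↑b + e_κ) ∈ {↑a, ↑a + e_ν}` — the two-block support of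
the one-step rows on NON-WRAPPING coarse bonds; every intermediate bond is again non-wrapping because its tip's block is a box point), `combF_mul_compRowsG_apply_ne_zero`
(the comb bond into `t̄` does not wrap: `tipOf_mem_pbox`), **`nestedRows_apply_ne_zero`**: `N p b ≠ 0 → quo L ↑b.1 = γ p ∧ quo L (↑b.1 + e_{b.2}) = γ p`.
(TB) is discharged for the record's `QSym Lc` in `FP/QstepSymTwoBlock` (this lineage); here it is a hypothesis.
WHAT THIS IS NOT: not (P-c) (the lattice twin `λℤ` and its unwrapping — the row's); not the VALUE identification of a block of the read-out with the reference-torus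
(`M₁ = fun _ => Lc`) read-out (J-NOTE-20 §8, next file of this lineage); no row of v9∕v10 discharged; nothing of Bałaban's asserted, valued or discharged; 0 estimates;
0∕4 row-D1 binders (hW, hR, D1Tel, D1Rep); ROOT M‴ p325680 untouched; NOT (C1), NOT (L2′), NOT (T-ID), NOT SDF, NOT D1, NEVER «G-an2-4 closed», NOT BetaPertH, NOT
continuum, NOT Clay.

HONEST DEPENDENCY (page 1, mandatory): continuum YM on T⁴ ⇐ BetaPertH ∧ nine spine estimates (0/9 proved); BetaPertH ⇐ (D1) ∧ (D4) ∧ CAP+tail;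
G-an2-4 gates asym, D1 and NE2/3/4.  HONEST FRAMING (cell contract, verbatim): «discharging `BetaPertH` makes Bałaban's UV stability UNCONDITIONAL —
a real constructive-QFT result; it is NOT the continuum limit and NOT the Clay problem.»  ABSOLUTE RULE (cell charter, verbatim): «No internally-minted
statement may enter as a cited fact. Every hypothesis is either kernel-proved in this package or a verbatim quotation of a PUBLISHED theorem with page
reference. The manuscript(s) under audit are NOT citable for their own disputed steps — they are the thing under adjudication; programme-internal
(2001/route/tribunal) claims are never citable.»  Road «FP» OWNER, b2b-balaban-beta-d1-p3 gen 54, 2026-08-29.  No existing file touched.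
-/

noncomputable section

namespace Summit.QuantumFields.BalabanUV.Beta.FP.TorusNestedReadoutRows

open Matrix Finset
open scoped BigOperators
open Literature.MathematicalPhysics.QuantumFieldTheory
open Literature.MathematicalPhysics.QuantumFieldTheory.Balaban1983to89
open Literature.MathematicalPhysics.QuantumFieldTheory.Balaban1983to89.Beta
open B5Prop11Plancherel (fine)
open B6Lemma24Torus (pbox mem_pbox)
open AffineAveraging (Site toSite unitVec)
open OneStepResolventKernel (Fib)
open Literature.MathematicalPhysics.QuantumFieldTheory.LatticeForm (quo)
open Summit.QuantumFields.BalabanUV.Beta.FP.KernelPeriodisationFib (Idx)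
open Summit.QuantumFields.BalabanUV.Beta.FP.TorusCombForest
open Summit.QuantumFields.BalabanUV.Beta.FP.TorusCombRows (Res combRowsT combBondT combBondT_eq baseOf_mem_pbox tipOf_mem_pbox)
open Summit.QuantumFields.BalabanUV.Beta.FP.TorusCombNestedBasis (quo_lift quo_mem_pbox)
open Summit.QuantumFields.BalabanUV.Beta.FP.TorusCompositeObjects
open Summit.QuantumFields.BalabanUV.Beta.FP.TorusCompositeObjectsG (StepRows compRowsG compRowsG_zero compRowsG_succ)
open Summit.QuantumFields.BalabanUV.Beta.FP.TorusCompositeUnimodular (bigRatio_dvd_towerTorus)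
open Summit.QuantumFields.BalabanUV.Beta.GAN24.StaircaseFaces (quo_quo)

variable {d : ℕ}

/-! ## §0 Generic finite-matrix support lemmas -/

section Generic

/-- [folklore] a nonzero entry of a product has a nonzero pair of factors. -/
theorem exists_of_mul_apply_ne_zero {l m o : Type*} [Fintype m] (A : Matrix l m ℝ) (B : Matrix m o ℝ) (i : l) (k : o) (h : (A * B) i k ≠ 0) :
    ∃ j, A i j ≠ 0 ∧ B j k ≠ 0 := by
  rw [Matrix.mul_apply] at h
  obtain ⟨j, _, hj⟩ := Finset.exists_ne_zero_of_sum_ne_zero h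
  exact ⟨j, left_ne_zero_of_mul hj, right_ne_zero_of_mul hj⟩

/-- [folklore] **THE INVERSE OF A BLOCK-DIAGONAL MATRIX IS BLOCK-DIAGONAL** (blocks = the fibres of a colouring `f`; Mathlib's `⁻¹` is `0` on singular matrices,
so no invertibility is needed): if `A i j = 0` whenever `f i ≠ f j`, then `A⁻¹ i j = 0` whenever `f i ≠ f j`. -/
theorem inv_apply_eq_zero_of_blockDiagonal {ι α : Type*} [Fintype ι] [DecidableEq ι] (f : ι → α) (A : Matrix ι ι ℝ)
    (hA : ∀ i j, f i ≠ f j → A i j = 0) (i j : ι) (hij : f i ≠ f j) : A⁻¹ i j = 0 := by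
  classical
  by_cases hu : IsUnit A.det
  · set D : Matrix ι ι ℝ := Matrix.diagonal fun k => if f k = f j then (1 : ℝ) else 0 with hD
    have hcomm : A * D = D * A := by
      ext a b
      rw [Matrix.mul_diagonal, Matrix.diagonal_mul]
      by_cases hab : f a = f b
      · rw [hab, mul_comm]
      · rw [hA a b hab, zero_mul, mul_zero]
    have key : A⁻¹ * D = D * A⁻¹ := by
      calc A⁻¹ * D = A⁻¹ * D * (A * A⁻¹) := by rw [Matrix.mul_nonsing_inv _ hu, Matrix.mul_one]
        _ = A⁻¹ * (D * A) * A⁻¹ := by simp only [Matrix.mul_assoc]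
        _ = A⁻¹ * (A * D) * A⁻¹ := by rw [hcomm]
        _ = D * A⁻¹ := by rw [← Matrix.mul_assoc, Matrix.nonsing_inv_mul _ hu, Matrix.one_mul]
    have e := congrFun (congrFun key i) j
    rw [Matrix.mul_diagonal, Matrix.diagonal_mul, if_pos rfl, mul_one, if_neg hij, zero_mul] at e
    exact e
  · rw [Matrix.nonsing_inv_apply_not_isUnit _ hu]; rfl

/-- [folklore] a row of `A *ᵥ X` depends only on `X` restricted to the support of that row of `A`. -/
theorem mulVec_apply_congr_of_support {m o : Type*} [Fintype o] (A : Matrix m o ℝ) (i : m) (X X' : o → ℝ)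
    (h : ∀ j, A i j ≠ 0 → X j = X' j) : (A *ᵥ X) i = (A *ᵥ X') i := by
  simp only [Matrix.mulVec, dotProduct]
  refine Finset.sum_congr rfl fun j _ => ?_
  by_cases hz : A i j = 0
  · rw [hz, zero_mul, zero_mul]
  · rw [h j hz]

end Generic

/-! ## §1 Lattice arithmetic: nested block indices, blocks of the comb endpoints, the big block of a nested slot -/

section Arith

/-- [folklore] points with the same block root have the same block index. -/
theorem quo_eq_of_rootOf_eq {ρ : Site (d + 1)} {N : ℕ} (hN : 0 < N) {x y : Site (d + 1)} (h : rootOf ρ N y = rootOf ρ N x) : quo N y = quo N x := by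
  funext i
  have hi := congrFun h i
  simp only [rootOf] at hi
  have hN0 : (N : ℤ) ≠ 0 := by exact_mod_cast hN.ne'
  exact mul_left_cancel₀ hN0 (add_right_cancel hi)

/-- [folklore] **BOTH ENDPOINTS OF THE COMB BOND INTO `x` LIE IN `x`'s BLOCK**: `quo N (baseOf x) = quo N x` and `quo N (tipOf x) = quo N x`. -/
theorem quo_baseOf_tipOf {ρ : Site (d + 1)} {N : ℕ} (hN : 0 < N) (hρ : ∀ i, 0 ≤ ρ i ∧ ρ i < N) {x : Site (d + 1)} (hx : x ≠ rootOf ρ N x) :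
    quo N (baseOf ρ N x) = quo N x ∧ quo N (tipOf ρ N x) = quo N x := by
  have hs : quo N (stepOf ρ N x) = quo N x := quo_eq_of_rootOf_eq hN (rootOf_stepOf hN hρ hx)
  by_cases hlt : rootOf ρ N x (axisOf ρ N x) < x (axisOf ρ N x)
  · rw [(base_tip_of_lt hlt).1, (base_tip_of_lt hlt).2]; exact ⟨hs, rfl⟩
  · rw [(base_tip_of_not_lt hlt).1, (base_tip_of_not_lt hlt).2]; exact ⟨rfl, hs⟩

/-- [folklore] the tip of the comb bond into `x` is its base point moved by the axis unit vector (definitional). -/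
theorem tipOf_eq (ρ : Site (d + 1)) (N : ℕ) (x : Site (d + 1)) : tipOf ρ N x = baseOf ρ N x + unitVec (axisOf ρ N x) := rfl

/-- [folklore] a lattice point whose `L`-block index is that of a box point lies in the box (`L ∣ T i`). -/
theorem mem_pbox_of_quo_eq {L : ℕ} (hL : 0 < L) {T : Fin (d + 1) → ℕ} (hT : ∀ i, L ∣ T i) {s : Site (d + 1)} (hs : s ∈ pbox T) {y : Site (d + 1)}
    (hq : quo L y = quo L s) : y ∈ pbox T := by
  rw [mem_pbox] at hs ⊢
  intro i
  have hL' : (0 : ℤ) < L := by exact_mod_cast hL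
  have hi : y i / (L : ℤ) = s i / (L : ℤ) := congrFun hq i
  obtain ⟨k, hk⟩ := hT i
  obtain ⟨h0, h1⟩ := hs i
  have hk' : (T i : ℤ) = (k : ℤ) * (L : ℤ) := by rw [hk]; push_cast; ring
  constructor
  · have : 0 ≤ y i / (L : ℤ) := by rw [hi]; exact Int.ediv_nonneg h0 hL'.le
    exact (Int.ediv_nonneg_iff_of_pos hL').1 this
  · have h2 : s i / (L : ℤ) < k := by rw [Int.ediv_lt_iff_lt_mul hL']; rw [← hk']; exact h1
    rw [← hi, Int.ediv_lt_iff_lt_mul hL', ← hk'] at h2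
    exact h2

/-- [folklore] a fine point lies in the fine box iff its block index lies in the coarse box (`N > 0`). -/
theorem mem_pbox_fine_iff {N : ℕ} (hN : 0 < N) (M : Fin (d + 1) → ℕ) (x : Site (d + 1)) : x ∈ pbox (fine N M) ↔ quo N x ∈ pbox M := by
  refine ⟨quo_mem_pbox hN, fun h => ?_⟩
  rw [mem_pbox] at h ⊢
  intro i
  have hN' : (0 : ℤ) < N := by exact_mod_cast hN
  obtain ⟨h0, h1⟩ := h i
  change 0 ≤ x i / (N : ℤ) at h0
  change x i / (N : ℤ) < (M i : ℤ) at h1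
  refine ⟨(Int.ediv_nonneg_iff_of_pos hN').1 h0, ?_⟩
  rw [Int.ediv_lt_iff_lt_mul hN'] at h1
  simp only [fine, Nat.cast_mul]
  linarith

variable (Lc : ℕ) [NeZero Lc]

/-- [folklore] **THE BIG BLOCK OF A TOP SLOT**: `quo (bigRatio (n+1)) (site of towerEquiv.symm (inl t̄)) = quo Lc t̄` (the site is `bigRatio n • t̄ + bigRoot(lower)`,
`0 ≤ bigRoot < bigRatio n`). -/
theorem quo_towerEquiv_symm_inl (M : Fin (d + 1) → ℕ) (rs : ℕ → (Fin (d + 1) → ℕ)) (hrs : ∀ k i, 0 ≤ toSite (rs k) i ∧ toSite (rs k) i < (Lc : ℤ))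
    (n : ℕ) (t : Res (toSite (rs 0)) Lc M) :
    quo (bigRatio Lc (n + 1)) ((towerEquiv Lc M rs hrs (n + 1)).symm (Sum.inl t)).site = quo Lc t.site := by
  have hLc : 0 < Lc := Nat.pos_of_ne_zero (NeZero.ne Lc)
  rw [towerEquiv_symm_inl_site, bigRatio_succ, ← quo_quo (bigRatio Lc n),
    quo_lift (bigRatio_pos Lc hLc n) (bigRoot_range Lc hLc n (fun k => rs (k + 1)) (fun k => hrs (k + 1)))]

/-- [folklore] **THE BIG BLOCK OF A LOWER SLOT** is the `Lc`-block of its big block one level down: `quo (bigRatio (n+1)) (site (inr x)) = quo Lc (quo (bigRatio n) (site x))`. -/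
theorem quo_towerEquiv_symm_inr (M : Fin (d + 1) → ℕ) (rs : ℕ → (Fin (d + 1) → ℕ)) (hrs : ∀ k i, 0 ≤ toSite (rs k) i ∧ toSite (rs k) i < (Lc : ℤ))
    (n : ℕ) (x : NParam Lc (fine Lc M) (fun k => rs (k + 1)) n) :
    quo (bigRatio Lc (n + 1)) ((towerEquiv Lc M rs hrs (n + 1)).symm (Sum.inr x)).site
      = quo Lc (quo (bigRatio Lc n) ((towerEquiv Lc (fine Lc M) (fun k => rs (k + 1)) (fun k => hrs (k + 1)) n).symm x).site) := by
  have hLc : 0 < Lc := Nat.pos_of_ne_zero (NeZero.ne Lc)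
  rw [towerEquiv_symm_inr_site, bigRatio_succ, ← quo_quo (bigRatio Lc n)]

end Arith

/-! ## §2 (L1) The rows of the nested slice read only bonds with BOTH endpoints in the slot's big block -/

section Rows

variable (Lc : ℕ) [NeZero Lc]

/-- [folklore] **A ONE-SHOT COMB ROW READS ONE BOND — the comb bond into its slot** (`combBondT_eq`: the fallback branch is dead under `Lc ∣ M i`). -/
theorem bigP_apply_ne_zero (M : Fin (d + 1) → ℕ) (rs : ℕ → (Fin (d + 1) → ℕ)) (hrs : ∀ k i, 0 ≤ toSite (rs k) i ∧ toSite (rs k) i < (Lc : ℤ))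
    (hM : ∀ i, Lc ∣ M i) (k : ℕ) (p : NParam Lc M rs k) (b : ↥(pbox (towerTorus Lc M k)) × Fin (d + 1)) (h : bigP Lc M rs hrs k p b ≠ 0) :
    (b.1 : Site (d + 1)) = baseOf (bigRoot Lc rs k) (bigRatio Lc k) ((towerEquiv Lc M rs hrs k).symm p).site ∧
      b.2 = axisOf (bigRoot Lc rs k) (bigRatio Lc k) ((towerEquiv Lc M rs hrs k).symm p).site := by
  have hLc : 0 < Lc := Nat.pos_of_ne_zero (NeZero.ne Lc)
  unfold bigP at h
  rw [Matrix.submatrix_apply] at h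
  simp only [combRowsT] at h
  rw [combBondT_eq (bigRatio_pos Lc hLc k) (bigRoot_range Lc hLc k rs hrs) (bigRatio_dvd_towerTorus Lc hM k)] at h
  split_ifs at h with he
  · rw [Prod.mk.injEq, Sum.inl.injEq] at he
    exact ⟨congrArg Subtype.val he.1, he.2⟩
  · exact absurd rfl h

/-- [folklore] **(L1) FOR THE ONE-SHOT COMB ROWS**: both endpoints of the bond read by row `p` lie in `p`'s block (ratio `bigRatio k`). -/
theorem bigP_apply_ne_zero_quo (M : Fin (d + 1) → ℕ) (rs : ℕ → (Fin (d + 1) → ℕ)) (hrs : ∀ k i, 0 ≤ toSite (rs k) i ∧ toSite (rs k) i < (Lc : ℤ))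
    (hM : ∀ i, Lc ∣ M i) (k : ℕ) (p : NParam Lc M rs k) (b : ↥(pbox (towerTorus Lc M k)) × Fin (d + 1)) (h : bigP Lc M rs hrs k p b ≠ 0) :
    quo (bigRatio Lc k) (b.1 : Site (d + 1)) = quo (bigRatio Lc k) ((towerEquiv Lc M rs hrs k).symm p).site ∧
      quo (bigRatio Lc k) ((b.1 : Site (d + 1)) + unitVec b.2) = quo (bigRatio Lc k) ((towerEquiv Lc M rs hrs k).symm p).site := by
  have hLc : 0 < Lc := Nat.pos_of_ne_zero (NeZero.ne Lc)
  obtain ⟨h1, h2⟩ := bigP_apply_ne_zero Lc M rs hrs hM k p b h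
  have hq := quo_baseOf_tipOf (bigRatio_pos Lc hLc k) (bigRoot_range Lc hLc k rs hrs) ((towerEquiv Lc M rs hrs k).symm p).not_root
  rw [h1, h2, ← tipOf_eq]
  exact hq

/-- [folklore] **A TOP COMB ROW READS ONE COARSE BOND — the comb bond into its slot.** -/
theorem combF_apply_ne_zero (M : Fin (d + 1) → ℕ) (r : Fin (d + 1) → ℕ) (hr : ∀ i, 0 ≤ toSite r i ∧ toSite r i < (Lc : ℤ)) (hM : ∀ i, Lc ∣ M i)
    (t : Res (toSite r) Lc M) (a : ↥(pbox M) × Fin (d + 1)) (h : combF Lc M r t a ≠ 0) :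
    (a.1 : Site (d + 1)) = baseOf (toSite r) Lc t.site ∧ a.2 = axisOf (toSite r) Lc t.site := by
  have hLc : 0 < Lc := Nat.pos_of_ne_zero (NeZero.ne Lc)
  by_cases he : ((a.1, Sum.inl a.2) : Idx M (Fib d)) = combBondT (toSite r) Lc M t
  · rw [combBondT_eq hLc hr hM, Prod.mk.injEq, Sum.inl.injEq] at he
    exact ⟨congrArg Subtype.val he.1, he.2⟩
  · exfalso; apply h
    show (if ((a.1, Sum.inl a.2) : Idx M (Fib d)) = combBondT (toSite r) Lc M t then (1 : ℝ) else 0) = 0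
    exact if_neg he

variable (Q : StepRows d Lc)
  (hQ : ∀ (M : Fin (d + 1) → ℕ) [∀ μ, NeZero (M μ)] (ℓ : ℕ) (r : Fin (d + 1) → ℕ) (a : ↥(pbox M)) (ν : Fin (d + 1))
      (b : ↥(pbox (fine Lc M))) (κ : Fin (d + 1)),
      (a : Site (d + 1)) + unitVec ν ∈ pbox M → Q M ℓ r (a, ν) (b, κ) ≠ 0 →
        (quo Lc (b : Site (d + 1)) = a ∨ quo Lc (b : Site (d + 1)) = (a : Site (d + 1)) + unitVec ν) ∧
        (quo Lc ((b : Site (d + 1)) + unitVec κ) = a ∨ quo Lc ((b : Site (d + 1)) + unitVec κ) = (a : Site (d + 1)) + unitVec ν))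
include hQ

/-- [folklore] **THE COMPOSITE AVERAGING ROW OF A NON-WRAPPING COARSE BOND `(a, ν)` READS ONLY FINEST BONDS WITH BOTH ENDPOINTS UNDER THE BLOCKS `a`, `a + e_ν`**
— induction on the depth over the displayed two-block letter (TB) of the one-step family `Q` (every intermediate bond is again non-wrapping because its tip's block is
a box point). -/
theorem compRowsG_apply_ne_zero : ∀ (k : ℕ) (M : Fin (d + 1) → ℕ) [∀ μ, NeZero (M μ)] (lev : ℕ → ℕ) (rs : ℕ → (Fin (d + 1) → ℕ))
    (a : ↥(pbox M)) (ν : Fin (d + 1)) (c : ↥(pbox (towerTorus Lc M k)) × Fin (d + 1)),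
    (a : Site (d + 1)) + unitVec ν ∈ pbox M → compRowsG Lc Q M lev rs k (a, ν) c ≠ 0 →
      (quo (Lc ^ k) (c.1 : Site (d + 1)) = a ∨ quo (Lc ^ k) (c.1 : Site (d + 1)) = (a : Site (d + 1)) + unitVec ν) ∧
      (quo (Lc ^ k) ((c.1 : Site (d + 1)) + unitVec c.2) = a ∨ quo (Lc ^ k) ((c.1 : Site (d + 1)) + unitVec c.2) = (a : Site (d + 1)) + unitVec ν)
  | 0, M, _, lev, rs, a, ν, c, _, h => by
    rw [compRowsG_zero, Matrix.one_apply] at h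
    split_ifs at h with he
    · subst he
      rw [pow_zero, ResolventComposition.quo_one, ResolventComposition.quo_one]
      exact ⟨Or.inl rfl, Or.inr rfl⟩
    · exact absurd rfl h
  | k + 1, M, _, lev, rs, a, ν, c, ha, h => by
    have hLc : 0 < Lc := Nat.pos_of_ne_zero (NeZero.ne Lc)
    rw [compRowsG_succ] at h
    obtain ⟨⟨b, κ⟩, h1, h2⟩ := exists_of_mul_apply_ne_zero _ _ _ _ h
    obtain ⟨hb1, hb2⟩ := hQ M (lev 1) (rs 1) a ν b κ ha h1
    have hbt : (b : Site (d + 1)) + unitVec κ ∈ pbox (fine Lc M) := by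
      rw [mem_pbox_fine_iff hLc]
      rcases hb2 with e | e <;> rw [e]
      · exact a.2
      · exact ha
    have ih := compRowsG_apply_ne_zero k (fine Lc M) (fun j => lev (j + 1)) (fun j => rs (j + 1)) b κ c hbt h2
    have key : ∀ z : Site (d + 1), (z = (b : Site (d + 1)) ∨ z = (b : Site (d + 1)) + unitVec κ) →
        (quo Lc z = a ∨ quo Lc z = (a : Site (d + 1)) + unitVec ν) := by
      rintro z (rfl | rfl)
      · exact hb1
      · exact hb2
    have step : ∀ y : Site (d + 1), (quo (Lc ^ k) y = (b : Site (d + 1)) ∨ quo (Lc ^ k) y = (b : Site (d + 1)) + unitVec κ) →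
        (quo (Lc ^ (k + 1)) y = a ∨ quo (Lc ^ (k + 1)) y = (a : Site (d + 1)) + unitVec ν) := by
      intro y hy
      rw [pow_succ, ← quo_quo (Lc ^ k)]
      exact key _ hy
    exact ⟨step _ ih.1, step _ ih.2⟩

/-- [folklore] **(L1) FOR THE TOP ROWS `τ₂ · Q₁₀`**: both endpoints of every finest bond read by the top comb row `t̄` composed with the full composite averaging lie
in `t̄`'s big block (`quo Lc t̄`): the comb bond into `t̄` does not wrap (`tipOf_mem_pbox`), so (TB) descends through `compRowsG_apply_ne_zero`. -/
theorem combF_mul_compRowsG_apply_ne_zero (M : Fin (d + 1) → ℕ) [∀ μ, NeZero (M μ)] (lev : ℕ → ℕ) (rs : ℕ → (Fin (d + 1) → ℕ))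
    (hrs0 : ∀ i, 0 ≤ toSite (rs 0) i ∧ toSite (rs 0) i < (Lc : ℤ)) (hM : ∀ i, Lc ∣ M i) (n : ℕ)
    (t : Res (toSite (rs 0)) Lc M) (c : ↥(pbox (towerTorus Lc M (n + 1))) × Fin (d + 1))
    (h : (combF Lc M (rs 0) * compRowsG Lc Q M lev rs (n + 1)) t c ≠ 0) :
    quo (bigRatio Lc (n + 1)) (c.1 : Site (d + 1)) = quo Lc t.site ∧
      quo (bigRatio Lc (n + 1)) ((c.1 : Site (d + 1)) + unitVec c.2) = quo Lc t.site := by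
  have hLc : 0 < Lc := Nat.pos_of_ne_zero (NeZero.ne Lc)
  obtain ⟨a, h1, h2⟩ := exists_of_mul_apply_ne_zero _ _ _ _ h
  obtain ⟨ha1, ha2⟩ := combF_apply_ne_zero Lc M (rs 0) hrs0 hM t a h1
  have htip : (a.1 : Site (d + 1)) + unitVec a.2 ∈ pbox M := by
    rw [ha1, ha2, ← tipOf_eq]; exact tipOf_mem_pbox hLc hrs0 hM t
  have hc := compRowsG_apply_ne_zero Lc Q hQ (n + 1) M lev rs a.1 a.2 c htip h2
  obtain ⟨hb, ht⟩ := quo_baseOf_tipOf hLc hrs0 t.not_root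
  have key : ∀ y : Site (d + 1), (quo (Lc ^ (n + 1)) y = (a.1 : Site (d + 1)) ∨ quo (Lc ^ (n + 1)) y = (a.1 : Site (d + 1)) + unitVec a.2) →
      quo (bigRatio Lc (n + 1)) y = quo Lc t.site := by
    intro y hy
    rw [bigRatio_eq_pow, pow_succ, ← quo_quo (Lc ^ (n + 1))]
    rcases hy with e | e
    · rw [e, ha1, hb]
    · rw [e, ha1, ha2, ← tipOf_eq, ht]
  exact ⟨key _ hc.1, key _ hc.2⟩

/-- [folklore] **(L1) — THE NESTED SLICE `N = fromRows (τ₂·Q₁₀) τ₁` READS ONLY INTRA-BIG-BLOCK BONDS**: if `N p b ≠ 0` then BOTH endpoints of the finest bond `b`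
(the tip UNWRAPPED) have big-block index `quo (bigRatio Lc (n+1)) (site of p)` — in particular a bond wrapping around the finest torus is never read. -/
theorem nestedRows_apply_ne_zero (M : Fin (d + 1) → ℕ) [∀ μ, NeZero (M μ)] (lev : ℕ → ℕ) (rs : ℕ → (Fin (d + 1) → ℕ))
    (hrs : ∀ k i, 0 ≤ toSite (rs k) i ∧ toSite (rs k) i < (Lc : ℤ)) (hM : ∀ i, Lc ∣ M i) (n : ℕ)
    (p : NParam Lc M rs (n + 1)) (b : ↥(pbox (towerTorus Lc M (n + 1))) × Fin (d + 1))
    (h : (Matrix.fromRows (combF Lc M (rs 0) * compRowsG Lc Q M lev rs (n + 1))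
        (bigP Lc (fine Lc M) (fun k => rs (k + 1)) (fun k => hrs (k + 1)) n)
          : Matrix (NParam Lc M rs (n + 1)) (↥(pbox (towerTorus Lc M (n + 1))) × Fin (d + 1)) ℝ) p b ≠ 0) :
    quo (bigRatio Lc (n + 1)) (b.1 : Site (d + 1)) = quo (bigRatio Lc (n + 1)) ((towerEquiv Lc M rs hrs (n + 1)).symm p).site ∧
      quo (bigRatio Lc (n + 1)) ((b.1 : Site (d + 1)) + unitVec b.2) = quo (bigRatio Lc (n + 1)) ((towerEquiv Lc M rs hrs (n + 1)).symm p).site := by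
  have hLc : 0 < Lc := Nat.pos_of_ne_zero (NeZero.ne Lc)
  rcases p with t | x
  · rw [Matrix.fromRows_apply_inl] at h
    rw [quo_towerEquiv_symm_inl]
    exact combF_mul_compRowsG_apply_ne_zero Lc Q hQ M lev rs (hrs 0) hM n t b h
  · rw [Matrix.fromRows_apply_inr] at h
    have hM' : ∀ i, Lc ∣ fine Lc M i := fun i => Dvd.intro (M i) rfl
    obtain ⟨h1, h2⟩ := bigP_apply_ne_zero_quo Lc (fine Lc M) (fun k => rs (k + 1)) (fun k => hrs (k + 1)) hM' n x b h
    rw [quo_towerEquiv_symm_inr, bigRatio_succ, ← quo_quo (bigRatio Lc n), ← quo_quo (bigRatio Lc n), h1, h2]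
    exact ⟨rfl, rfl⟩

end Rows

end Summit.QuantumFields.BalabanUV.Beta.FP.TorusNestedReadoutRows

end
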